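import Summits.QuantumFields.YangMills.Theorems.UnitScaleTiltProp8HalvingQuarterCubeSeq
import Summits.QuantumFields.YangMills.Theorems.UnitScaleTiltProp8FlatPortBodyL0
import HarnessLib

/-!
# Route `UnitScaleTilt`, crux K1 child «MinimiserStabilityRegPr» (stmt-QuantumFields-19200), registered stub V2′ `stub_halvingStep`
# (skeletons v8 5b4e846794b80374 / v9 pen) — **[Balaban1985Variational] (164) AT THE CUBE-SEQUENCE CARRIER, UNCONDITIONALLY IN THE P2 TEXT, FOR
# EVERY ODD `L ≥ 5` ON TORI WITH `≥ 5L` BIG BLOCKS**: `HalvingQuarterCubeSeq.rows164_quarter_cubeSeqMT3_top` fed BY NAME by p1 g18's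
# `FlatPortBodyL0.body_of_adm22` — the body of the registered P2 text `FlatCubeOpsText.FlatOpsAdmAtMS` over lit-balaban's G-F3′-L0 endpoint
# `B6Cor28EntriesKLevelV1L0.cor28_kLevel_H_DH` — so that the ¼-term of (167) is a theorem modulo the near/far SIZES of the datum only
# ((160): `HalvingDatum160`; (155) ⇐ (152): pillar P1)

Cell `ym3-torus` (HUMAN RULING D-0037, YM ladder rung R3 — continuum SU(2) YM₃ on the torus is a RUNG, not the Clay problem), width seat
`ym-ust-19200-w3` gen 2 (D-0149; payload: «consume G-F3′-L0 endpoint `B6Cor28EntriesKLevelV1L0.cor28_kLevel_H_DH` by name» — done here through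
the P2 lineage's port `FlatPortBodyL0`, the consumer of record of that endpoint).  `--supports stmt-QuantumFields-19200 --as helper`; def-free,
0 sorry, standard axioms.

THE PRINT ([Balaban1985Variational] p. 303–304): *«It follows from the inequalities (2.47)–(2.51) of [3] that B₃ depends on d and L only. We may
assume that R₁M₁ is sufficiently big, so that B₃e^{−½δ₀R₁M₁} ≦ ½. (163) Then we get on Δ |HB|, |∇^ηHB|, |∂^{η*}∂^ηHB|, |Δ^ηHB| < ¼M_Δ max{B₃ε₁, ½ε₀}.
(164)»* — [3] = [Balaban1984PropagatorsII], whose Cor. 2.8 (2.150)–(2.151) at `k` levels (unit cubes `Λ₀` allowed) is lit-balaban's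
`cor28_kLevel_H_DH`, ported to the P2 letters by `FlatPortBodyL0.body_of_adm22`.

WHAT THIS FILE PROVES: **`quarter164_L5`** — for every odd `L = ℓ + 1 ≥ 5` there are `M_h⁰, R₀ : ℕ` and `B₀ ≥ 0`, `δ₀ > 0`, `B₃ > 0` (depending on
`L` only) such that for every member `F = ⟨L, m⟩`, heights `1 ≤ K − n`, `K − n + 1 ≤ m + K`, big blocks `M = L·M_h`, `M_h = L^{a′} ≥ M_h⁰`, `R ≥ R₀`,
torus size `a′ + 3 ≤ m + n`, every centre `x₀`, inner radius `ρ` and separation `S ≥ R·M`, and the level weights `w` of `D := cubeSeqMT3 F n K x₀ ρ S M`: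
THERE ARE the canonical pinned `H`, `G̃` of `D` with their guarded letters (P2's body) AND, for every `b` within `r₀` blocks of the centre, every
`C, M_Δ, ε₁, ε₀ ≥ 0`, `R₁M₁ ≥ 0` with (163) `4CB₀B₃e^{−½δ₀R₁M₁} ≤ ½` and `R₁M₁ ≤ ρ − r₀ − 1`, and every datum `X` of near size `C·M_Δ·ε₁·(distBI + 1)` on
the top level and far size `C·M_Δ·ε₀·L^{k−j(c)}` below: (164) `|HX(b)|, Lᵏ|∇HX(b)|, |∂^{η*}∂^ηHX(b)|, L²ᵏ|ΔHX(b)| ≤ ¼M_Δ max{4CB₀B₃ε₁, ½ε₀}`.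
HONEST SCOPE: `L = 3` ((P2-L3), lit-balaban's `…L3` entries) and tori with fewer than `5L` big blocks ((P2-small)) are NOT covered, exactly as in
`FlatPortBodyL0`; (160)/(155)/(152)/(156) are hypotheses.  Bookkeeping only; NOT a claim about the crux, the rung, or the mass gap.

References: T. Bałaban, CMP **102** (1985) 277–309 [Balaban1985Variational] (144) p.300, (155) p.302, (160)–(163) p.303, (164) p.304;
CMP **96** (1984) 223–250 [Balaban1984PropagatorsII] (2.1)–(2.4) p.224, Prop. 2.6 (2.136) p.247, Cor. 2.8 (2.150)–(2.151) p.249.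
-/

set_option autoImplicit false

noncomputable section

open scoped BigOperators

namespace Summit.QuantumFields.YangMills.Theorems.HalvingQuarterL5

open Literature.MathematicalPhysics.QuantumFieldTheory.Balaban1983to89
open B5Eq117TorusCarriers (Mk)
open B5Eq118OneStroke (iterBlockOf)
open B5Prop12FieldsLattice (distSite)
open B6GlobalChartV1 (PV)
open B6SectADomainsV1 (Domains)
open B6SectAOperatorsV1 (BondIdx dcE dcsE)
open T3ContinuumYM3Torus (T3Family)
open FlatCubeOpsText (Adm22 distBI IsLevWeight IsFlatH IsFlatGt HSupLetterG GtSupLetterG GtLaplaceLetterG HDecayLetterD RowSum162)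
open FlatCubeSequenceAligned (cubeSeqMT3)
open FlatCubeSequenceAdm (adm22_cubeSeqMT3)
open FlatPortBodyL0 (body_of_adm22)
open HalvingQuarterCubeSeq (rows164_quarter_cubeSeqMT3_top)

/-- `1 ≤ 3` (named once). [folklore] -/
private theorem hd3 : 1 ≤ 2 + 1 := by norm_num

/-- **(164) AT THE CUBE SEQUENCE, UNCONDITIONALLY IN THE P2 TEXT, EVERY ODD `L ≥ 5`, TORI WITH `≥ 5L` BIG BLOCKS** (`FlatPortBodyL0.body_of_adm22` +
`FlatCubeSequenceAdm.adm22_cubeSeqMT3` + `HalvingQuarterCubeSeq.rows164_quarter_cubeSeqMT3_top`): see the module docstring for the binder list.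
[cite: Balaban1985Variational, (160)-(163) p.303, (164) p.304; Balaban1984PropagatorsII, (2.1)-(2.2) p.224, Cor. 2.8 (2.150)-(2.151) p.249] -/
theorem quarter164_L5 (ℓ : ℕ) (hL : Odd (ℓ + 1) ∧ 1 < ℓ + 1) (hℓ : 4 ≤ ℓ) :
    ∃ (Mh₀ R₀ : ℕ) (B₀ δ₀ B₃ : ℝ), 0 ≤ B₀ ∧ 0 < δ₀ ∧ 0 < B₃ ∧
    ∀ (m : ℕ) (hm : 1 ≤ m) (n K : ℕ) (_ : 1 ≤ K - n) (_ : K - n + 1 ≤ m + K) {Mh R a' : ℕ} (_ : Mh = (ℓ + 1) ^ a') (_ : Mh₀ ≤ Mh) (_ : R₀ ≤ R)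
      (_ : a' + 3 ≤ m + n) (hM1 : 1 ≤ (ℓ + 1) * Mh) (x₀ : Site (PV 2 ℓ m K hd3 hL) 0) (ρ S : ℕ) (_ : R * ((ℓ + 1) * Mh) ≤ S)
      (w : ℕ → PBond (PV 2 ℓ m K hd3 hL) 0 → ℝ)
      (_ : IsLevWeight (⟨ℓ + 1, hL, m, hm⟩ : T3Family) n K (cubeSeqMT3 (⟨ℓ + 1, hL, m, hm⟩ : T3Family) n K x₀ ρ S ((ℓ + 1) * Mh) hM1) w),
      ∃ (H : (BondIdx (cubeSeqMT3 (⟨ℓ + 1, hL, m, hm⟩ : T3Family) n K x₀ ρ S ((ℓ + 1) * Mh) hM1) → ℝ) →ₗ[ℝ] (PBond (PV 2 ℓ m K hd3 hL) 0 → ℝ))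
        (Gt : (PBond (PV 2 ℓ m K hd3 hL) 0 → ℝ) →ₗ[ℝ] (PBond (PV 2 ℓ m K hd3 hL) 0 → ℝ)),
        IsFlatH (⟨ℓ + 1, hL, m, hm⟩ : T3Family) n K (cubeSeqMT3 (⟨ℓ + 1, hL, m, hm⟩ : T3Family) n K x₀ ρ S ((ℓ + 1) * Mh) hM1) H ∧ IsFlatGt (⟨ℓ + 1, hL, m, hm⟩ : T3Family) n K (cubeSeqMT3 (⟨ℓ + 1, hL, m, hm⟩ : T3Family) n K x₀ ρ S ((ℓ + 1) * Mh) hM1) Gt ∧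
        HSupLetterG (⟨ℓ + 1, hL, m, hm⟩ : T3Family) n K (cubeSeqMT3 (⟨ℓ + 1, hL, m, hm⟩ : T3Family) n K x₀ ρ S ((ℓ + 1) * Mh) hM1) w H B₀ ∧ GtSupLetterG (⟨ℓ + 1, hL, m, hm⟩ : T3Family) n K w Gt B₀ ∧
        GtLaplaceLetterG (⟨ℓ + 1, hL, m, hm⟩ : T3Family) n K w Gt B₀ ∧
        ∀ (C MΔ ε₁ ε₀ R₁M₁ r₀ : ℝ), 0 ≤ C → 0 ≤ MΔ → 0 ≤ ε₁ → 0 ≤ ε₀ → 0 ≤ R₁M₁ →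
          4 * C * B₀ * B₃ * Real.exp (-(δ₀ / 2 * R₁M₁)) ≤ 1 / 2 → R₁M₁ ≤ (ρ : ℝ) - r₀ - 1 →
          ∀ (X : BondIdx (cubeSeqMT3 (⟨ℓ + 1, hL, m, hm⟩ : T3Family) n K x₀ ρ S ((ℓ + 1) * Mh) hM1) → ℝ) (b : PBond (PV 2 ℓ m K hd3 hL) 0),
            distSite (Mk (PV 2 ℓ m K hd3 hL) (K - n)) (iterBlockOf (K - n) b.src) (iterBlockOf (K - n) x₀) ≤ r₀ →
            (∀ c : BondIdx (cubeSeqMT3 (⟨ℓ + 1, hL, m, hm⟩ : T3Family) n K x₀ ρ S ((ℓ + 1) * Mh) hM1), (c.1.1 : ℕ) = K - n →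
              |X c| ≤ C * MΔ * ε₁ * (distBI (cubeSeqMT3 (⟨ℓ + 1, hL, m, hm⟩ : T3Family) n K x₀ ρ S ((ℓ + 1) * Mh) hM1) b c + 1)) →
            (∀ c : BondIdx (cubeSeqMT3 (⟨ℓ + 1, hL, m, hm⟩ : T3Family) n K x₀ ρ S ((ℓ + 1) * Mh) hM1), (c.1.1 : ℕ) < K - n →
              |X c| ≤ C * MΔ * ε₀ * (((ℓ + 1 : ℕ) : ℝ)) ^ ((K - n) - (c.1.1 : ℕ))) →
            |H X b| ≤ 1 / 4 * MΔ * max (4 * C * B₀ * B₃ * ε₁) (ε₀ / 2) ∧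
            (∀ ν : Fin 3, (((ℓ + 1 : ℕ) : ℝ)) ^ (K - n) * |H X ⟨b.src.shift ν, b.dir⟩ - H X b| ≤ 1 / 4 * MΔ * max (4 * C * B₀ * B₃ * ε₁) (ε₀ / 2)) ∧
            |(dcsE ((((ℓ + 1 : ℕ) : ℝ)) ^ (K - n)) (dcE ((((ℓ + 1 : ℕ) : ℝ)) ^ (K - n)) (WithLp.toLp 2 (H X)))) b| ≤
              1 / 4 * MΔ * max (4 * C * B₀ * B₃ * ε₁) (ε₀ / 2) ∧
            ((((ℓ + 1 : ℕ) : ℝ)) ^ (K - n)) ^ 2 * |∑ ν : Fin 3, ((H X b - H X ⟨b.src.shift ν, b.dir⟩) + (H X b - H X ⟨b.src.unshift ν, b.dir⟩))| ≤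
              1 / 4 * MΔ * max (4 * C * B₀ * B₃ * ε₁) (ε₀ / 2) := by
  obtain ⟨Mh₀, R₀, B₀, δ₀, B₃, hδ₀, hB₃, hmain⟩ := body_of_adm22 ℓ hL hℓ
  -- `B₀ ≥ 0` is forced by the guarded (46)-letter at the zero datum once an admissible instance is at hand; up front we export `max B₀ 0`
  -- and identify it with `B₀` inside the body.
  refine ⟨Mh₀, R₀, max B₀ 0, δ₀, B₃, le_max_right _ _, hδ₀, hB₃, ?_⟩
  intro m hm n K hk1 hk' Mh R a' hMha hMh hR hsize hM1 x₀ ρ S hRS w hw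
  have hnK : n < K := by omega
  have hAdm : Adm22 (cubeSeqMT3 (⟨ℓ + 1, hL, m, hm⟩ : T3Family) n K x₀ ρ S ((ℓ + 1) * Mh) hM1) R ((ℓ + 1) * Mh) :=
    adm22_cubeSeqMT3 (⟨ℓ + 1, hL, m, hm⟩ : T3Family) n K x₀ ρ hM1 hRS
  obtain ⟨H, Gt, hFH, hFG, hHs, hGs, hGl, dBI, hdom, h162, hHd⟩ :=
    hmain m hm n K hk1 hk' hMha hMh hR hsize (cubeSeqMT3 (⟨ℓ + 1, hL, m, hm⟩ : T3Family) n K x₀ ρ S ((ℓ + 1) * Mh) hM1) rfl hAdm w hw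
  -- `0 ≤ B₀` from the guarded sup letter at `X = 0`, `t = 1`
  have hB₀ : 0 ≤ B₀ := by
    have h := (hHs 0 1 zero_le_one (fun c => by simp)).1 ⟨x₀, ⟨0, by norm_num⟩⟩
    simpa using h
  have hmax : max B₀ 0 = B₀ := max_eq_left hB₀
  refine ⟨H, Gt, hFH, hFG, by rw [hmax]; exact hHs, by rw [hmax]; exact hGs, by rw [hmax]; exact hGl, ?_⟩
  intro C MΔ ε₁ ε₀ R₁M₁ r₀ hC hMΔ hε₁ hε₀ hR1 h163 hρ X b hb hnear hfar
  rw [hmax] at h163 ⊢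
  exact rows164_quarter_cubeSeqMT3_top (F := (⟨ℓ + 1, hL, m, hm⟩ : T3Family)) hnK x₀ ρ S ((ℓ + 1) * Mh) hM1 hw hdom hHd h162 hδ₀.le hB₀
    hB₃.le hC hMΔ hε₁ hε₀ hR1 h163 hρ hb hnear hfar

end Summit.QuantumFields.YangMills.Theorems.HalvingQuarterL5

end
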